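import Mathlib
import Summits.ValiantsHypothesis.ValiantsHypothesis.Theorems.LacunarySymmetroidMatrixDescartesInertiaBand
import Summits.ValiantsHypothesis.ValiantsHypothesis.Theorems.LacunarySymmetroidMatrixDescartesInertiaIndexFormula

/-!
# `MatrixDescartes` (stmt-ValiantsHypothesis-18050) — THE MONOTONE INCOHERENCE LAW: in a Loewner-monotone word only the
# columns outside a sign-coherent core produce zeros — `Z₊ ≤ k` WITH MULTIPLICITY, at every size and for all exponents

HONEST FRAMING.  Cell `pub-symmetroid`, seat `val-sym-mdr-p2` (gen 20); helper file `--supports` the crux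
`Theses.LacunarySymmetroid.MatrixDescartes` (OPEN), NO closure claim; companion of `…InertiaBand` (the band
`ν(B) − #{extra σ>0} ≤ ν(F(x)) ≤ ν(B) + #{extra σ<0}`) and of the lineage's one-type window law
(`Inertia.card_roots_Ioo_add_negIndex_eq_of_posType`, `…InertiaIndexFormula`).  A SECTOR law that refines the one-sided
rung `Z₊ ≤ m`; nothing here bears on the crux in its window, `stub_twoSided`, `DoorA26` / `DoorA34`, registers, or `VP ≠ VNP`.

THE SECTOR (monotone words).  `B` real symmetric, `det B ≠ 0`, at exponent `e`; signed columns with `σⱼ > 0 ∧ δⱼ > e` or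
`σⱼ < 0 ∧ δⱼ < e` (positive squares ABOVE the base, negative squares BELOW it), so that `x^{−e}F(x)` is Loewner-increasing —
the one-sided rung of the tree is the case «all σ > 0».  Columns split into a SIGN-COHERENT CORE `U₀` (Gram `U₀ᵀB⁻¹U₀` PSD on
its positive columns, NSD on its negative ones) and `k` EXTRA columns `U₁`.

* `word_eq_optionPencil` / `eval_word_eq_optionPencil` — the word is the lacunary pencil with letters indexed by
  `Option ρ`: `none ↦ B` at `e`, `some j ↦ σⱼ·uⱼuⱼᵀ` at `δⱼ` (so the lineage's `Inertia` calculus applies verbatim).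
* `posType_of_monotone` — every positive root of a monotone word is of POSITIVE TYPE: for a kernel vector `u ≠ 0` of `F(t)`,
  `t·P_u′(t) = Σⱼ (δⱼ − e)σⱼ t^{δⱼ}(uⱼ·u)² > 0` (each term `≥ 0`; all vanish only if `u ⊥` every column, and then `Bu = 0`).
* **`card_posRoots_multiset_le_of_monotone` (THE MONOTONE INCOHERENCE LAW).**  On the sector, the positive roots of `det F`
  COUNTED WITH MULTIPLICITY number at most `k = |ρ₁|` — the number of columns outside the coherent core — for every size,
  all exponents, any signs as above.  Proof: one-type window law between a scale below and a scale above all positive roots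
  (`#roots = ν(F(a)) − ν(F(b))`) and the band law at both ends (`ν(F(a)) ≤ ν(B) + #{extra σ<0}`, `ν(F(b)) ≥ ν(B) − #{extra σ>0}`).
  `card_posRoots_le_of_monotone`: distinct roots.  With an EMPTY core this is `Z₊ ≤ #columns` (weaker than the tree's `≤ m`);
  the content is `k ≪ m`: e.g. a one-sided PSD word whose columns span a `B⁻¹`-nonnegative subspace except for `k` of them has
  at most `k` positive zeros however large `m`, `K` and the exponents are — the FRAME LAW's count
  (`#{j : σⱼ·uⱼᵀB⁻¹uⱼ < 0}`, pairwise orthogonal columns) WITHOUT a frame, in the monotone sector.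
The two-sided analogue is NOT claimed: off the monotone sector roots of both types occur (revivals) and the band bounds only
the inertia drift, not the count (cf. `Inertia.index_formula`).

[folklore] (Sylvester's law of inertia along a monotone matrix family; Haynsworth).  Axioms `propext`, `Classical.choice`,
`Quot.sound`.
-/

-- layout Summits/ValiantsHypothesis/ValiantsHypothesis forces the duplicated namespace component
set_option linter.dupNamespace false

namespace Summit.ValiantsHypothesis.ValiantsHypothesis.Theorems.LacunarySymmetroidMatrixDescartes

open Polynomial Matrix Finset
open scoped BigOperators

namespace GramDual

section Monotone

variable {ι ρ ρ₀ ρ₁ : Type} [Fintype ι] [DecidableEq ι] [Fintype ρ] [DecidableEq ρ] [Fintype ρ₀] [DecidableEq ρ₀]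
  [Fintype ρ₁] [DecidableEq ρ₁]

/-- the signed column part (file-local notation, as in `…GramDualSigned`) -/
local notation3 (prettyPrint := false) "𝕊[" U ", " σ ", " δ "]" =>
  ((U : Matrix _ _ ℝ).map Polynomial.C
      * Matrix.diagonal (fun j => Polynomial.C ((σ : _ → ℝ) j) * (Polynomial.X : Polynomial ℝ) ^ (δ j : ℕ))
      * ((U : Matrix _ _ ℝ).map Polynomial.C)ᵀ)

/-- the option-indexed letters of a signed column word (file-local notation) -/
local notation3 (prettyPrint := false) "𝕃[" B ", " U ", " σ "]" =>
  (fun o : Option _ => Option.elim o (B : Matrix _ _ ℝ)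
    (fun j => (σ : _ → ℝ) j • Matrix.vecMulVec (fun a => (U : Matrix _ _ ℝ) a j) (fun a => (U : Matrix _ _ ℝ) a j)))

/-- the option-indexed exponents (file-local notation) -/
local notation3 (prettyPrint := false) "𝕕[" e ", " δ "]" => (fun o : Option _ => Option.elim o (e : ℕ) (δ : _ → ℕ))

/-! ## §1  A signed column word is a lacunary pencil with letters indexed by `Option ρ` -/

omit [Fintype ι] [DecidableEq ι] in
/-- **Polynomial form**: `X^e B + U diag(σX^δ) Uᵀ = Σ_{o : Option ρ} X^{d o} S_o` with `S_none = B`, `d none = e`,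
`S_{some j} = σⱼ·uⱼuⱼᵀ`, `d (some j) = δⱼ`. [folklore] -/
theorem word_eq_optionPencil (B : Matrix ι ι ℝ) (U : Matrix ι ρ ℝ) (σ : ρ → ℝ) (e : ℕ) (δ : ρ → ℕ) :
    ((Polynomial.X : Polynomial ℝ) ^ e) • B.map Polynomial.C + 𝕊[U, σ, δ]
      = ∑ o : Option ρ, ((Polynomial.X : Polynomial ℝ) ^ (𝕕[e, δ] o)) • (𝕃[B, U, σ] o).map Polynomial.C := by
  rw [Fintype.sum_option]
  simp only [Option.elim_none, Option.elim_some]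
  congr 1
  refine Matrix.ext fun a b => ?_
  rw [Matrix.mul_apply, Matrix.sum_apply]
  refine Finset.sum_congr rfl fun j _ => ?_
  rw [Matrix.mul_diagonal, Matrix.transpose_apply, Matrix.map_apply, Matrix.map_apply, Matrix.smul_apply,
    Matrix.map_apply, Matrix.smul_apply, Matrix.vecMulVec_apply, smul_eq_mul, smul_eq_mul]
  simp only [map_mul]
  ring

omit [Fintype ι] [DecidableEq ι] in
/-- **Evaluated form**: `x^e B + U diag(σx^δ) Uᵀ = Σ_o x^{d o} S_o`. [folklore] -/
theorem eval_word_eq_optionPencil (B : Matrix ι ι ℝ) (U : Matrix ι ρ ℝ) (σ : ρ → ℝ) (e : ℕ) (δ : ρ → ℕ)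
    (x : ℝ) :
    x ^ e • B + U * Matrix.diagonal (fun j => σ j * x ^ δ j) * Uᵀ = ∑ o : Option ρ, x ^ (𝕕[e, δ] o) • 𝕃[B, U, σ] o := by
  rw [Fintype.sum_option]
  simp only [Option.elim_none, Option.elim_some]
  congr 1
  refine Matrix.ext fun a b => ?_
  rw [Matrix.mul_apply, Matrix.sum_apply]
  refine Finset.sum_congr rfl fun j _ => ?_
  rw [Matrix.mul_diagonal, Matrix.transpose_apply, Matrix.smul_apply, Matrix.smul_apply, Matrix.vecMulVec_apply,
    smul_eq_mul, smul_eq_mul]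
  ring

omit [Fintype ι] [DecidableEq ι] [Fintype ρ] [DecidableEq ρ] in
/-- The option-indexed letters are symmetric. [folklore] -/
theorem isSymm_optionLetter {B : Matrix ι ι ℝ} (hBs : B.IsSymm) (U : Matrix ι ρ ℝ) (σ : ρ → ℝ) :
    ∀ o : Option ρ, (𝕃[B, U, σ] o).IsSymm := by
  intro o
  cases o with
  | none => exact hBs
  | some j =>
    simp only [Option.elim_some]
    refine Matrix.IsSymm.smul ?_ _
    unfold Matrix.IsSymm
    rw [Matrix.transpose_vecMulVec]

/-! ## §2  Monotone words have positive-type roots -/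

omit [DecidableEq ι] in
/-- The Rayleigh form of a rank-one letter: `uᵀ(σ vvᵀ)u = σ (v·u)²`. [folklore] -/
theorem form_rankOne (σ : ℝ) (v u : ι → ℝ) : u ⬝ᵥ ((σ • Matrix.vecMulVec v v) *ᵥ u) = σ * (v ⬝ᵥ u) ^ 2 := by
  rw [Matrix.smul_mulVec, dotProduct_smul, smul_eq_mul, Matrix.vecMulVec_mulVec, dotProduct_smul, MulOpposite.smul_eq_mul_unop,
    MulOpposite.unop_op, dotProduct_comm u v]
  ring

omit [DecidableEq ι] in
/-- A rank-one letter acts by `(σ vvᵀ)u = σ(v·u)·v`. [folklore] -/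
theorem rankOne_mulVec (σ : ℝ) (v u : ι → ℝ) : (σ • Matrix.vecMulVec v v) *ᵥ u = (σ * (v ⬝ᵥ u)) • v := by
  rw [Matrix.smul_mulVec, Matrix.vecMulVec_mulVec, op_smul_eq_smul, smul_smul]

omit [DecidableEq ι] [DecidableEq ρ] in
/-- The Rayleigh form of the evaluated option pencil: `uᵀF(t)u = Σ_o t^{d o}·uᵀS_ou`. [folklore] -/
theorem form_optionPencil (B : Matrix ι ι ℝ) (U : Matrix ι ρ ℝ) (σ : ρ → ℝ) (e : ℕ) (δ : ρ → ℕ) (t : ℝ) (u : ι → ℝ) :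
    u ⬝ᵥ ((∑ o : Option ρ, t ^ (𝕕[e, δ] o) • 𝕃[B, U, σ] o) *ᵥ u)
      = ∑ o : Option ρ, t ^ (𝕕[e, δ] o) * (u ⬝ᵥ ((𝕃[B, U, σ] o) *ᵥ u)) := by
  rw [Matrix.sum_mulVec, dotProduct_sum]
  refine Finset.sum_congr rfl fun o _ => ?_
  rw [Matrix.smul_mulVec, dotProduct_smul, smul_eq_mul]

omit [Fintype ι] [DecidableEq ι] [Fintype ρ] [DecidableEq ρ] in
/-- The derivative of the Rayleigh `K`-nomial, evaluated: `t·P_u′(t) = Σ_o d_o·c_o·t^{d_o}`. [folklore] -/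
theorem eval_derivative_rayleigh {κ : Type} [Fintype κ] (c : κ → ℝ) (d : κ → ℕ) (t : ℝ) :
    t * (derivative (∑ k, Polynomial.C (c k) * (Polynomial.X : Polynomial ℝ) ^ d k)).eval t
      = ∑ k, (d k : ℝ) * c k * t ^ d k := by
  rw [Polynomial.derivative_sum, Polynomial.eval_finsetSum, Finset.mul_sum]
  refine Finset.sum_congr rfl fun k _ => ?_
  rw [Polynomial.derivative_C_mul_X_pow, Polynomial.eval_mul, Polynomial.eval_C, Polynomial.eval_pow, Polynomial.eval_X]
  rcases Nat.eq_zero_or_pos (d k) with h0 | hpos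
  · rw [h0]; simp
  · have : t * t ^ (d k - 1) = t ^ d k := by
      rw [← pow_succ', Nat.sub_add_cancel hpos]
    calc t * (c k * (d k : ℝ) * t ^ (d k - 1)) = (d k : ℝ) * c k * (t * t ^ (d k - 1)) := by ring
      _ = (d k : ℝ) * c k * t ^ d k := by rw [this]

omit [DecidableEq ρ] in
/-- **Monotone words have positive-type roots.**  `det B ≠ 0`, columns with `σⱼ > 0 ∧ δⱼ > e` or `σⱼ < 0 ∧ δⱼ < e`: at every
`t > 0` and every non-zero kernel vector `u` of `F(t)`, the Rayleigh `K`-nomial `P_u` has `P_u′(t) > 0`. [folklore] -/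
theorem posType_of_monotone (B : Matrix ι ι ℝ) (hBu : IsUnit B.det) (U : Matrix ι ρ ℝ) (σ : ρ → ℝ) (e : ℕ)
    (δ : ρ → ℕ) (hmono : ∀ j, (0 < σ j ∧ e < δ j) ∨ (σ j < 0 ∧ δ j < e)) :
    ∀ t : ℝ, 0 < t → (∑ o : Option ρ, t ^ (𝕕[e, δ] o) • 𝕃[B, U, σ] o).det = 0 →
      ∀ u : ι → ℝ, (∑ o : Option ρ, t ^ (𝕕[e, δ] o) • 𝕃[B, U, σ] o) *ᵥ u = 0 → u ≠ 0 →
        0 < (derivative (∑ o : Option ρ, Polynomial.C (u ⬝ᵥ ((𝕃[B, U, σ] o) *ᵥ u))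
          * (Polynomial.X : Polynomial ℝ) ^ (𝕕[e, δ] o))).eval t := by
  classical
  intro t ht _ u hu hu0
  -- the kernel relation `Σ_o t^{d_o} c_o = 0`
  have hker : ∑ o : Option ρ, t ^ (𝕕[e, δ] o) * (u ⬝ᵥ ((𝕃[B, U, σ] o) *ᵥ u)) = 0 := by
    rw [← form_optionPencil, hu, dotProduct_zero]
  -- `t · P'(t) = Σ_o d_o c_o t^{d_o} = Σ_o (d_o − e) c_o t^{d_o}` and the `none` term vanishes
  have hderiv := eval_derivative_rayleigh (fun o : Option ρ => u ⬝ᵥ ((𝕃[B, U, σ] o) *ᵥ u)) (𝕕[e, δ]) t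
  have hshift : ∑ o : Option ρ, ((𝕕[e, δ] o : ℕ) : ℝ) * (u ⬝ᵥ ((𝕃[B, U, σ] o) *ᵥ u)) * t ^ (𝕕[e, δ] o)
      = ∑ j : ρ, ((δ j : ℝ) - e) * (σ j * ((fun a => U a j) ⬝ᵥ u) ^ 2) * t ^ δ j := by
    have h1 : ∑ o : Option ρ, ((𝕕[e, δ] o : ℕ) : ℝ) * (u ⬝ᵥ ((𝕃[B, U, σ] o) *ᵥ u)) * t ^ (𝕕[e, δ] o)
        = ∑ o : Option ρ, (((𝕕[e, δ] o : ℕ) : ℝ) - e) * (u ⬝ᵥ ((𝕃[B, U, σ] o) *ᵥ u)) * t ^ (𝕕[e, δ] o) := by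
      have h2 : ∑ o : Option ρ, (e : ℝ) * (u ⬝ᵥ ((𝕃[B, U, σ] o) *ᵥ u)) * t ^ (𝕕[e, δ] o) = 0 := by
        have h3 : ∑ o : Option ρ, (e : ℝ) * (u ⬝ᵥ ((𝕃[B, U, σ] o) *ᵥ u)) * t ^ (𝕕[e, δ] o)
            = (e : ℝ) * ∑ o : Option ρ, t ^ (𝕕[e, δ] o) * (u ⬝ᵥ ((𝕃[B, U, σ] o) *ᵥ u)) := by
          rw [Finset.mul_sum]
          exact Finset.sum_congr rfl fun o _ => by ring
        rw [h3, hker, mul_zero]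
      rw [← sub_zero (∑ o : Option ρ, ((𝕕[e, δ] o : ℕ) : ℝ) * (u ⬝ᵥ ((𝕃[B, U, σ] o) *ᵥ u)) * t ^ (𝕕[e, δ] o)), ← h2,
        ← Finset.sum_sub_distrib]
      exact Finset.sum_congr rfl fun o _ => by ring
    rw [h1, Fintype.sum_option]
    simp only [Option.elim_none, Option.elim_some, sub_self, zero_mul, zero_add]
    exact Finset.sum_congr rfl fun j _ => by rw [form_rankOne]
  -- each term is `≥ 0`
  have hterm_nonneg : ∀ j, 0 ≤ ((δ j : ℝ) - e) * (σ j * ((fun a => U a j) ⬝ᵥ u) ^ 2) * t ^ δ j := by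
    intro j
    have hcoef : 0 ≤ ((δ j : ℝ) - e) * σ j := by
      rcases hmono j with ⟨hs, hd⟩ | ⟨hs, hd⟩
      · exact mul_nonneg (sub_nonneg.2 (by exact_mod_cast hd.le)) hs.le
      · exact mul_nonneg_of_nonpos_of_nonpos (sub_nonpos.2 (by exact_mod_cast hd.le)) hs.le
    have : ((δ j : ℝ) - e) * (σ j * ((fun a => U a j) ⬝ᵥ u) ^ 2) * t ^ δ j
        = (((δ j : ℝ) - e) * σ j) * (((fun a => U a j) ⬝ᵥ u) ^ 2 * t ^ δ j) := by ring
    rw [this]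
    exact mul_nonneg hcoef (mul_nonneg (sq_nonneg _) (pow_pos ht _).le)
  -- not all terms vanish: otherwise `u ⊥` every column and `B u = 0`
  have hex : ∃ j, 0 < ((δ j : ℝ) - e) * (σ j * ((fun a => U a j) ⬝ᵥ u) ^ 2) * t ^ δ j := by
    by_contra hnone
    push Not at hnone
    have hzero : ∀ j, (fun a => U a j) ⬝ᵥ u = 0 := by
      intro j
      have hle := hnone j
      have hcoef : 0 < ((δ j : ℝ) - e) * σ j := by
        rcases hmono j with ⟨hs, hd⟩ | ⟨hs, hd⟩
        · exact mul_pos (sub_pos.2 (by exact_mod_cast hd)) hs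
        · exact mul_pos_of_neg_of_neg (sub_neg.2 (by exact_mod_cast hd)) hs
      by_contra hne
      have hpos : 0 < ((δ j : ℝ) - e) * (σ j * ((fun a => U a j) ⬝ᵥ u) ^ 2) * t ^ δ j := by
        have : ((δ j : ℝ) - e) * (σ j * ((fun a => U a j) ⬝ᵥ u) ^ 2) * t ^ δ j
            = (((δ j : ℝ) - e) * σ j) * (((fun a => U a j) ⬝ᵥ u) ^ 2 * t ^ δ j) := by ring
        rw [this]
        exact mul_pos hcoef (mul_pos (by positivity) (pow_pos ht _))
      exact absurd hle (not_le.2 hpos)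
    -- `F(t) u = t^e B u`
    have hFu : (∑ o : Option ρ, t ^ (𝕕[e, δ] o) • 𝕃[B, U, σ] o) *ᵥ u = t ^ e • (B *ᵥ u) := by
      rw [Matrix.sum_mulVec, Fintype.sum_option]
      simp only [Option.elim_none, Option.elim_some, Matrix.smul_mulVec, Matrix.vecMulVec_mulVec, hzero,
        MulOpposite.op_zero, zero_smul, smul_zero, Finset.sum_const_zero, add_zero]
    rw [hFu] at hu
    have hBu0 : B *ᵥ u = 0 := by
      rcases smul_eq_zero.1 hu with h | h
      · exact absurd h (pow_ne_zero _ ht.ne')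
      · exact h
    exact hu0 (Matrix.eq_zero_of_mulVec_eq_zero hBu.ne_zero hBu0)
  -- conclude: `t · P'(t) > 0`
  obtain ⟨j₀, hj₀⟩ := hex
  have hsum : 0 < ∑ j : ρ, ((δ j : ℝ) - e) * (σ j * ((fun a => U a j) ⬝ᵥ u) ^ 2) * t ^ δ j :=
    lt_of_lt_of_le hj₀ (Finset.single_le_sum (fun j _ => hterm_nonneg j) (Finset.mem_univ j₀))
  rw [← hshift, ← hderiv] at hsum
  exact pos_of_mul_pos_right hsum ht.le

/-! ## §3  The monotone incoherence law -/

/-- **THE MONOTONE INCOHERENCE LAW.**  `B` real symmetric with `det B ≠ 0`; monotone signed columns (`σ > 0` above `e`,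
`σ < 0` below `e`) split into a SIGN-COHERENT core `U₀` (Gram PSD on its positive columns, NSD on its negative ones) and `k`
extra columns `U₁`.  Then the positive roots of `det(X^eB + U₀ diag(σ₀X^{δ₀})U₀ᵀ + U₁ diag(σ₁X^{δ₁})U₁ᵀ)` counted WITH
MULTIPLICITY number at most `k` — at every size and for all exponents. [folklore] -/
theorem card_posRoots_multiset_le_of_monotone (B : Matrix ι ι ℝ) (hBs : B.IsSymm) (hBu : IsUnit B.det)
    (U₀ : Matrix ι ρ₀ ℝ) (U₁ : Matrix ι ρ₁ ℝ) (σ₀ : ρ₀ → ℝ) (σ₁ : ρ₁ → ℝ) (e : ℕ) (δ₀ : ρ₀ → ℕ) (δ₁ : ρ₁ → ℕ)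
    (hmono₀ : ∀ j, (0 < σ₀ j ∧ e < δ₀ j) ∨ (σ₀ j < 0 ∧ δ₀ j < e))
    (hmono₁ : ∀ j, (0 < σ₁ j ∧ e < δ₁ j) ∨ (σ₁ j < 0 ∧ δ₁ j < e))
    (hP : ∀ v : ρ₀ → ℝ, (∀ j, σ₀ j < 0 → v j = 0) → 0 ≤ v ⬝ᵥ ((U₀ᵀ * B⁻¹ * U₀) *ᵥ v))
    (hN : ∀ v : ρ₀ → ℝ, (∀ j, 0 < σ₀ j → v j = 0) → v ⬝ᵥ ((U₀ᵀ * B⁻¹ * U₀) *ᵥ v) ≤ 0) :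
    Multiset.card ((Matrix.det (((Polynomial.X : Polynomial ℝ) ^ e) • B.map Polynomial.C + 𝕊[U₀, σ₀, δ₀] + 𝕊[U₁, σ₁, δ₁])
        ).roots.filter (fun t => 0 < t)) ≤ Fintype.card ρ₁ := by
  classical
  -- signs and monotonicity of the juxtaposed column system
  have hσ₀ : ∀ j, σ₀ j ≠ 0 := fun j => by
    rcases hmono₀ j with ⟨h, -⟩ | ⟨h, -⟩
    · exact h.ne'
    · exact h.ne
  have hσ₁ : ∀ j, σ₁ j ≠ 0 := fun j => by
    rcases hmono₁ j with ⟨h, -⟩ | ⟨h, -⟩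
    · exact h.ne'
    · exact h.ne
  have hmono : ∀ j : ρ₀ ⊕ ρ₁, (0 < Sum.elim σ₀ σ₁ j ∧ e < Sum.elim δ₀ δ₁ j) ∨ (Sum.elim σ₀ σ₁ j < 0 ∧ Sum.elim δ₀ δ₁ j < e) :=
    fun j => by cases j with | inl j => exact hmono₀ j | inr j => exact hmono₁ j
  -- the word as an option pencil
  rw [add_assoc, ← signedPart_fromCols, word_eq_optionPencil]
  set S := 𝕃[B, Matrix.fromCols U₀ U₁, Sum.elim σ₀ σ₁] with hSdef
  set d := 𝕕[e, Sum.elim δ₀ δ₁] with hddef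
  have hS : ∀ o, (S o).IsSymm := isSymm_optionLetter hBs (Matrix.fromCols U₀ U₁) (Sum.elim σ₀ σ₁)
  set P := Matrix.det (∑ o : Option (ρ₀ ⊕ ρ₁), ((Polynomial.X : Polynomial ℝ) ^ d o) • (S o).map Polynomial.C) with hPdef
  by_cases hP0 : P = 0
  · rw [hP0, Polynomial.roots_zero, Multiset.filter_zero, Multiset.card_zero]
    exact Nat.zero_le _
  -- the positive roots as a finset
  set T := P.roots.toFinset.filter (fun t => 0 < t) with hTdef
  by_cases hT : T = ∅
  · have h0 : P.roots.filter (fun t => 0 < t) = 0 := by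
      refine Multiset.filter_eq_nil.2 fun t ht hpos => ?_
      have : t ∈ T := by
        rw [hTdef, Finset.mem_filter, Multiset.mem_toFinset]
        exact ⟨ht, hpos⟩
      rw [hT] at this
      exact absurd this (Finset.notMem_empty t)
    rw [h0, Multiset.card_zero]
    exact Nat.zero_le _
  have hTne : T.Nonempty := Finset.nonempty_iff_ne_empty.2 hT
  set a₀ := T.min' hTne with ha₀def
  set b₀ := T.max' hTne with hb₀def
  have hmemT : ∀ {t : ℝ}, t ∈ T ↔ t ∈ P.roots ∧ 0 < t := fun {t} => by
    rw [hTdef, Finset.mem_filter, Multiset.mem_toFinset]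
  have ha₀pos : 0 < a₀ := (hmemT.1 (Finset.min'_mem T hTne)).2
  set a := a₀ / 2 with hadef
  set b := b₀ + 1 with hbdef
  have hapos : 0 < a := by rw [hadef]; linarith
  have hab : a < b := by
    have : a₀ ≤ b₀ := Finset.min'_le T b₀ (Finset.max'_mem T hTne)
    rw [hadef, hbdef]; linarith
  -- every positive root lies in `(a, b)`; `a`, `b` are not roots
  have hroot_window : ∀ t ∈ P.roots, (0 < t ↔ a < t ∧ t < b) := by
    intro t ht
    constructor
    · intro hpos
      have htT : t ∈ T := hmemT.2 ⟨ht, hpos⟩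
      have h1 : a₀ ≤ t := Finset.min'_le T t htT
      have h2 : t ≤ b₀ := Finset.le_max' T t htT
      rw [hadef, hbdef]
      constructor <;> linarith
    · intro h
      linarith [h.1]
  have hnotroot : ∀ {s : ℝ}, 0 < s → (s < a₀ ∨ b₀ < s) → (∑ o : Option (ρ₀ ⊕ ρ₁), s ^ d o • S o).det ≠ 0 := by
    intro s hs hout hdet
    have hsroot : s ∈ P.roots := by
      rw [Polynomial.mem_roots hP0, Polynomial.IsRoot.def, hPdef, DefiniteMoments.eval_det_pencil]
      exact hdet
    have hsT : s ∈ T := hmemT.2 ⟨hsroot, hs⟩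
    rcases hout with h | h
    · exact absurd (Finset.min'_le T s hsT) (not_le.2 h)
    · exact absurd (Finset.le_max' T s hsT) (not_le.2 h)
  have ha : (∑ o : Option (ρ₀ ⊕ ρ₁), a ^ d o • S o).det ≠ 0 := hnotroot hapos (Or.inl (by rw [hadef]; linarith))
  have hb : (∑ o : Option (ρ₀ ⊕ ρ₁), b ^ d o • S o).det ≠ 0 :=
    hnotroot (lt_trans hapos hab) (Or.inr (by rw [hbdef]; linarith))
  -- the one-type window law on `(a, b)`
  have hpos := posType_of_monotone B hBu (Matrix.fromCols U₀ U₁) (Sum.elim σ₀ σ₁) e (Sum.elim δ₀ δ₁) hmono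
  have hwin := (Inertia.card_roots_Ioo_add_negIndex_eq_of_posType d S hS hab ha hb
    (fun t hat htb hdet u hu hu0 => hpos t (lt_trans hapos hat) hdet u hu hu0)).1
  rw [← hPdef] at hwin
  -- all positive roots are the roots in `(a, b)`
  have hfilter : P.roots.filter (fun t => 0 < t) = P.roots.filter (fun t => a < t ∧ t < b) :=
    Multiset.filter_congr hroot_window
  rw [hfilter]
  -- the band law at both ends
  have hFa : (a ^ e • B + Matrix.fromCols U₀ U₁
      * Matrix.diagonal (fun j => Sum.elim σ₀ σ₁ j * a ^ (Sum.elim δ₀ δ₁ j)) * (Matrix.fromCols U₀ U₁)ᵀ).IsHermitian :=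
    isHermitian_eval_word hBs (Matrix.fromCols U₀ U₁) (Sum.elim σ₀ σ₁) e (Sum.elim δ₀ δ₁) a
  have hFb : (b ^ e • B + Matrix.fromCols U₀ U₁
      * Matrix.diagonal (fun j => Sum.elim σ₀ σ₁ j * b ^ (Sum.elim δ₀ δ₁ j)) * (Matrix.fromCols U₀ U₁)ᵀ).IsHermitian :=
    isHermitian_eval_word hBs (Matrix.fromCols U₀ U₁) (Sum.elim σ₀ σ₁) e (Sum.elim δ₀ δ₁) b
  have hB : B.IsHermitian := Inertia.isHermitian_of_isSymm hBs
  have hbanda := (inertia_word_band B U₀ U₁ σ₀ σ₁ e δ₀ δ₁ hBs hBu hσ₀ hσ₁ hP hN hapos hB hFa).1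
  have hbandb := (inertia_word_band B U₀ U₁ σ₀ σ₁ e δ₀ δ₁ hBs hBu hσ₀ hσ₁ hP hN (lt_trans hapos hab) hB hFb).1
  -- transport the indices between the two presentations of `F(a)`, `F(b)`
  have hνa := Inertia.negIndex_congr (Inertia.isHermitian_pencil d S hS a) hFa
    (eval_word_eq_optionPencil B (Matrix.fromCols U₀ U₁) (Sum.elim σ₀ σ₁) e (Sum.elim δ₀ δ₁) a).symm
  have hνb := Inertia.negIndex_congr (Inertia.isHermitian_pencil d S hS b) hFb
    (eval_word_eq_optionPencil B (Matrix.fromCols U₀ U₁) (Sum.elim σ₀ σ₁) e (Sum.elim δ₀ δ₁) b).symm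
  rw [hνa, hνb] at hwin
  have hk : Fintype.card {j // 0 < σ₁ j} ≤ Fintype.card ρ₁ := Fintype.card_subtype_le _
  omega

/-- **The monotone incoherence law, distinct roots**: `Z₊ ≤ k`. [folklore] -/
theorem card_posRoots_le_of_monotone (B : Matrix ι ι ℝ) (hBs : B.IsSymm) (hBu : IsUnit B.det)
    (U₀ : Matrix ι ρ₀ ℝ) (U₁ : Matrix ι ρ₁ ℝ) (σ₀ : ρ₀ → ℝ) (σ₁ : ρ₁ → ℝ) (e : ℕ) (δ₀ : ρ₀ → ℕ) (δ₁ : ρ₁ → ℕ)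
    (hmono₀ : ∀ j, (0 < σ₀ j ∧ e < δ₀ j) ∨ (σ₀ j < 0 ∧ δ₀ j < e))
    (hmono₁ : ∀ j, (0 < σ₁ j ∧ e < δ₁ j) ∨ (σ₁ j < 0 ∧ δ₁ j < e))
    (hP : ∀ v : ρ₀ → ℝ, (∀ j, σ₀ j < 0 → v j = 0) → 0 ≤ v ⬝ᵥ ((U₀ᵀ * B⁻¹ * U₀) *ᵥ v))
    (hN : ∀ v : ρ₀ → ℝ, (∀ j, 0 < σ₀ j → v j = 0) → v ⬝ᵥ ((U₀ᵀ * B⁻¹ * U₀) *ᵥ v) ≤ 0) :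
    ((Matrix.det (((Polynomial.X : Polynomial ℝ) ^ e) • B.map Polynomial.C + 𝕊[U₀, σ₀, δ₀] + 𝕊[U₁, σ₁, δ₁])
        ).roots.toFinset.filter (fun t => 0 < t)).card ≤ Fintype.card ρ₁ := by
  classical
  refine le_trans ?_ (card_posRoots_multiset_le_of_monotone B hBs hBu U₀ U₁ σ₀ σ₁ e δ₀ δ₁ hmono₀ hmono₁ hP hN)
  rw [← Multiset.toFinset_filter]
  exact Multiset.toFinset_card_le _

/-- **One-sided PSD words: only the columns outside a PSD-Gram core produce zeros.**  All signs positive, all exponents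
above `e`, core Gram `U₀ᵀB⁻¹U₀ ⪰ 0` ⇒ `Z₊ ≤ k` (with multiplicity). [folklore] -/
theorem card_posRoots_multiset_le_of_oneSided_psd (B : Matrix ι ι ℝ) (hBs : B.IsSymm) (hBu : IsUnit B.det)
    (U₀ : Matrix ι ρ₀ ℝ) (U₁ : Matrix ι ρ₁ ℝ) (σ₀ : ρ₀ → ℝ) (σ₁ : ρ₁ → ℝ) (e : ℕ) (δ₀ : ρ₀ → ℕ) (δ₁ : ρ₁ → ℕ)
    (hσ₀ : ∀ j, 0 < σ₀ j) (hσ₁ : ∀ j, 0 < σ₁ j) (hδ₀ : ∀ j, e < δ₀ j) (hδ₁ : ∀ j, e < δ₁ j)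
    (hC : (U₀ᵀ * B⁻¹ * U₀).PosSemidef) :
    Multiset.card ((Matrix.det (((Polynomial.X : Polynomial ℝ) ^ e) • B.map Polynomial.C + 𝕊[U₀, σ₀, δ₀] + 𝕊[U₁, σ₁, δ₁])
        ).roots.filter (fun t => 0 < t)) ≤ Fintype.card ρ₁ :=
  card_posRoots_multiset_le_of_monotone B hBs hBu U₀ U₁ σ₀ σ₁ e δ₀ δ₁ (fun j => Or.inl ⟨hσ₀ j, hδ₀ j⟩)
    (fun j => Or.inl ⟨hσ₁ j, hδ₁ j⟩)
    (fun v _ => by simpa only [star_trivial] using hC.dotProduct_mulVec_nonneg v)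
    (fun v hv => by
      have hv0 : v = 0 := funext fun j => hv j (hσ₀ j)
      rw [hv0, Matrix.mulVec_zero, dotProduct_zero])

end Monotone

end GramDual

end Summit.ValiantsHypothesis.ValiantsHypothesis.Theorems.LacunarySymmetroidMatrixDescartes
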